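import Mathlib
import HarnessLib
import Summits.CriticalPhenomena.CardyFormulaZ2.Theorems.CardyMagicRigidityMagicFormulaTSplit
import Summits.CriticalPhenomena.CardyFormulaZ2.Theorems.CardyMagicRigidityMagicFormulaTFourthOrder
import Summits.CriticalPhenomena.CardyFormulaZ2.Theorems.CardyMagicRigidityTransferContinuityReduction
import Literature.Probability.RandomPlanarGeometry.NestingTransform
import Literature.Probability.Percolation.FullPlaneCNL
import Literature.Probability.Percolation.TriCorrLengthExponentDecomposition

/-!
# Line `Sketch` for crux `MagicFormulaT`, wave-1 sub-goal: the four-point power-sum limit EXISTS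
# modulo the published inputs

Crux `Summit.CriticalPhenomena.CardyFormulaZ2.Theses.CardyMagicRigidity.MagicFormulaT`
(stmt-CriticalPhenomena-4836), line `Sketch`, sub-goal `fourPoint_existsLimit_of_facts`.

Notation.  For an admissible density `f` (measurable, `|f| ≤ C`, `f = 0` off `B̄(0, R)`, `∫ f = 0`) and a
loop `u` put `θ_u = u.nestingPhase f`; with `L` the loops of `siteLoopConfig δ ω` put
`A_m = Σᶠ_{u ∈ L} θ_u^m` and `Φ_δ(t) = E_{1/2}[∏ᶠ_{u ∈ L} 2cos(t θ_u + π/3)]` (`t ∈ ℂ`).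

**Statement.**  Given Camia–Newman's full-plane CLE₆ limit (`exists_isFullPlaneCNLLaw`) and Smirnov–Werner's
four-arm exponent (`SmirnovWerner2001_fourArm_scalingLimit`) as hypotheses, the order-4 statistic
`E_{1/2}[9A₁⁴ − 72A₁²A₂ + 48A₂² + 96A₁A₃ − 80A₄]` has a (real) limit as `δ → 0⁺`.

**Proof.**  By `Split.coeffLimitsExistT_of_facts` at `k = 4` the fourth Taylor coefficient `Φ_δ''''(0)`
has a complex limit `a` along `𝓝[>] 0` (its loop index set is `(siteLoopConfig δ ω).loops` by
`Theorems.loops_siteLoopConfig`, and its phase is `u.nestingPhase f` by definition).  For every `δ > 0`,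
i.e. eventually along `𝓝[>] 0`, `Φ_δ''''(0)` is the complexification of the order-4 statistic
(`fo_iteratedDeriv_four_eq_ofReal_integral`); taking real parts, the statistic tends to `L := a.re`.
No named fact is used beyond the two hypotheses; no definition is introduced.
-/

noncomputable section

namespace Summit.CriticalPhenomena.CardyFormulaZ2.Cruxes.MagicFormulaT.LineSketch

open MeasureTheory Filter Set
open scoped Real Topology BigOperators ENNReal
open Literature.Probability.RandomPlanarGeometry Literature.Probability.Percolation
  Literature.Probability.LatticeModels
open Summit.CriticalPhenomena.CardyFormulaZ2.Theorems

/-- **Sub-goal `fourPoint_existsLimit_of_facts` · the four-point power-sum limit exists modulo the published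
inputs.**  Given `exists_isFullPlaneCNLLaw` (Camia–Newman 2006) and `SmirnovWerner2001_fourArm_scalingLimit`
(Smirnov–Werner 2001), for every admissible density `f` the order-4 statistic
`E_{1/2}[9A₁⁴ − 72A₁²A₂ + 48A₂² + 96A₁A₃ − 80A₄]`, `A_m = Σᶠ_u θ_u(f)^m` over the loops of `siteLoopConfig δ ω`,
converges as `δ → 0⁺`: the fourth Taylor coefficient `Φ_δ''''(0)` converges to some `a : ℂ`
(`Split.coeffLimitsExistT_of_facts`, `k = 4`, rewritten along `Theorems.loops_siteLoopConfig`), it equals the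
complexified statistic for `δ > 0` (`fo_iteratedDeriv_four_eq_ofReal_integral`), and the witness is `a.re`. -/
theorem fourPoint_existsLimit_of_facts : exists_isFullPlaneCNLLaw → SmirnovWerner2001_fourArm_scalingLimit →
    ∀ (f : ℂ → ℝ) (R C : ℝ), Measurable f → (∀ z, |f z| ≤ C) → (∀ z, R < ‖z‖ → f z = 0) → ∫ z, f z = 0 →
    ∃ L : ℝ, Tendsto (fun δ : ℝ ↦ ∫ ω, (9 * (∑ᶠ u ∈ (siteLoopConfig δ ω).loops, u.nestingPhase f) ^ 4 -
      72 * (∑ᶠ u ∈ (siteLoopConfig δ ω).loops, u.nestingPhase f) ^ 2 *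
        (∑ᶠ u ∈ (siteLoopConfig δ ω).loops, u.nestingPhase f ^ 2) +
      48 * (∑ᶠ u ∈ (siteLoopConfig δ ω).loops, u.nestingPhase f ^ 2) ^ 2 +
      96 * (∑ᶠ u ∈ (siteLoopConfig δ ω).loops, u.nestingPhase f) *
        (∑ᶠ u ∈ (siteLoopConfig δ ω).loops, u.nestingPhase f ^ 3) -
      80 * (∑ᶠ u ∈ (siteLoopConfig δ ω).loops, u.nestingPhase f ^ 4)) ∂(triSitePercolation half))
      (𝓝[>] (0 : ℝ)) (𝓝 L) := by
  intro hCN hSW f R C hf hC hR h0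
  obtain ⟨a, ha⟩ := Split.coeffLimitsExistT_of_facts hCN hSW f R C hf hC hR h0 4
  simp_rw [← loops_siteLoopConfig] at ha
  have ha' : Tendsto (fun δ : ℝ ↦ iteratedDeriv 4 (fun t : ℂ ↦ ∫ ω, (∏ᶠ u ∈ (siteLoopConfig δ ω).loops,
      2 * Complex.cos (t * ((u.nestingPhase f : ℝ) : ℂ) + (Real.pi : ℂ) / 3)) ∂(triSitePercolation half)) 0)
      (𝓝[>] (0 : ℝ)) (𝓝 a) := ha
  refine ⟨a.re, ((Complex.continuous_re.tendsto a).comp ha').congr' ?_⟩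
  filter_upwards [self_mem_nhdsWithin] with δ hδ
  rw [Function.comp_apply, fo_iteratedDeriv_four_eq_ofReal_integral hf hC hR h0 (mem_Ioi.1 hδ),
    Complex.ofReal_re]

end Summit.CriticalPhenomena.CardyFormulaZ2.Cruxes.MagicFormulaT.LineSketch

end
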